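import Literature.Algebra.EuclideanLattices.LatticeTableCodeFP
import HarnessLib

/-!
# Reading a `GapSVP` instance code and writing a `GapCVP` instance code in polynomial time (typed `FP`)

Topic `Algebra/EuclideanLattices` (family `pqc`), sequel of `LatticeTableCodeFP.lean` (`latticeTableFP`,
`gapSVPTableFP`: the codes of lattice / `GapSVP` instances are computed in polynomial time from a list
matrix; `latticeInstance_encode_toMat`). A Karp- or Cook-reduction BETWEEN lattice problems reads the code
of its input instance and writes codes of instances of the target problem; the first component of
Peikert's `GapSVP → LWE` reduction (`Cryptography/PeikertReduction.lean`, pqc.S20) reads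
`code (B, d)` and queries its `BDD`/`CVP` solver on `code ((M·B, x), r)`. This file supplies both ends in
the typed algebra `CodeFP` (no machine is written), all PROVED:

* unfoldings of the codes: `matrixCode_toMat`, `gapSVPInstance_encode_eq`, `gapCVPInstance_encode_toMat`;
* **reading** — `GapCodes.svpTup p = ((n, row-major entries), (num d, den d))` with
  `GapSVPInstance.encode p = svpTupE (svpTup p)` (`encode_eq_svpTupE`), whence the typed projections
  from the INSTANCE CODE: `svpN_codeFP` (binary `n`), `svpNUn_codeFP` (unary `n`, capped by the code
  length, `n ≤ |code|`), `svpRows_codeFP` (the basis as a list of rows, `tab n n`, equal to the `ofFn`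
  rows `matRows B`, `svpRows_eq_matRows`), `svpNum_codeFP`, `svpDen_codeFP`;
* **writing** — `GapCodes.cvpCode n rows xs num den`, the code of `((⟨n, toMat n n rows⟩, xs), num/den)`
  when `xs` lists the target and `num/den` is in lowest terms (`cvpCode_eq_encode`), and
  **`cvpCode_codeFP`**: `(((1ⁿ, rows), xs), (num, den)) ↦ cvpCode …` is typed polynomial time.

## References

* D. Micciancio, S. Goldwasser, *Complexity of Lattice Problems*, Kluwer 2002, Ch. 1 §1.2 (codes of
  lattice instances; `GapSVP`, `GapCVP`) [MicciancioGoldwasser2002].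
* S. Arora, B. Barak, *Computational Complexity: A Modern Approach*, CUP 2009, §0.1, §1.3 [AroraBarak2009].
-/

namespace Literature.Algebra.EuclideanLattices

open _root_.Computability Literature.Computability.Complexity Literature.Computability.Complexity.CodeFP
  Literature.Computability.Complexity.LMat

/-! ### Unfolding the codes -/

/-- The matrix part of the code of `⟨N, toMat N N X⟩` is `listE smE (rowMajor N X)`. [cite: MicciancioGoldwasser2002, Ch. 1 §1.2] -/
theorem matrixCode_toMat (N : ℕ) (X : List (List ℤ)) :
    (encodingIntMatrixFin N).encode (toMat N N X) = listE smE (rowMajor N X) := by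
  have h := latticeInstance_encode_toMat N X
  rw [LatticeInstance.encode_eq, ← boolPair_encodeNat] at h
  have h' := congrArg (fun w => (boolUnpair w).2) h
  simpa only [boolUnpair_boolPair] using h'

/-- **The code of a `GapSVP` instance**: `code (I, d) = ⟨code I, ⟨smE (num d), bin (den d)⟩⟩`.
[cite: MicciancioGoldwasser2002, Ch. 1 Def. 1.4 / §1.2] -/
theorem gapSVPInstance_encode_eq (I : LatticeInstance) (d : ℚ) :
    GapSVPInstance.encode (I, d) = boolPair I.encode (boolPair (smE d.num) (encodeNat d.den)) := rfl

/-- **The code of a `GapCVP` instance on a list matrix**: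
`code ((⟨N, toMat N N X⟩, t), r) = ⟨⟨bin N, ⟨listE smE (rowMajor N X), listE smE [t₀, …]⟩⟩, ⟨smE (num r), bin (den r)⟩⟩`.
[cite: MicciancioGoldwasser2002, Ch. 1 Def. 1.5 / §1.2] -/
theorem gapCVPInstance_encode_toMat (N : ℕ) (X : List (List ℤ)) (t : Fin N → ℤ) (r : ℚ) :
    GapCVPInstance.encode (⟨⟨N, toMat N N X⟩, t⟩, r) =
      boolPair (boolPair (encodeNat N) (boolPair (listE smE (rowMajor N X)) (listE smE (List.ofFn t))))
        (boolPair (smE r.num) (encodeNat r.den)) := by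
  show boolPair (boolPair (encodeNat N) (boolPair ((encodingIntMatrixFin N).encode (toMat N N X))
      (encodingIntBool.listBool.encode (List.ofFn t)))) (boolPair (encodingIntBool.encode r.num) (encodeNat r.den)) = _
  rw [matrixCode_toMat, listE_eq]
  rfl

namespace GapCodes

/-! ### Reading a `GapSVP` instance code -/

/-- The `ofFn` rows of a square integer matrix. [folklore] -/
def matRows {n : ℕ} (B : Matrix (Fin n) (Fin n) ℤ) : List (List ℤ) := List.ofFn fun i => List.ofFn (B i)

/-- Entries of `matRows`. [folklore] -/
theorem ent_matRows {n : ℕ} (B : Matrix (Fin n) (Fin n) ℤ) (i j : Fin n) : ent (matRows B) i j = B i j := by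
  simp [ent, matRows]

/-- `toMat n n (matRows B) = B`. [folklore] -/
theorem toMat_matRows {n : ℕ} (B : Matrix (Fin n) (Fin n) ℤ) : toMat n n (matRows B) = B := by
  funext i j; exact ent_matRows B i j

/-- The typed data of a `GapSVP` instance: `((n, row-major entries of B), (num d, den d))`.
[cite: MicciancioGoldwasser2002, Ch. 1 §1.2] -/
def svpTup (p : GapSVPInstance) : (ℕ × List ℤ) × (ℤ × ℕ) :=
  ((p.1.n, rowMajor p.1.n (matRows p.1.basis)), (p.2.num, p.2.den))

/-- The structured code of the typed data. [folklore] -/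
abbrev svpTupE : (ℕ × List ℤ) × (ℤ × ℕ) → List Bool := pairE (pairE natE (listE smE)) (pairE smE natE)

/-- **The instance code is the structured code of the typed data.** [cite: MicciancioGoldwasser2002, Ch. 1 §1.2] -/
theorem encode_eq_svpTupE (p : GapSVPInstance) : GapSVPInstance.encode p = svpTupE (svpTup p) := by
  obtain ⟨⟨n, B⟩, d⟩ := p
  rw [gapSVPInstance_encode_eq]
  have hI : (⟨n, B⟩ : LatticeInstance) = ⟨n, toMat n n (matRows B)⟩ := by rw [toMat_matRows]
  have hcode : LatticeInstance.encode ⟨n, B⟩ = boolPair (encodeNat n) (listE smE (rowMajor n (matRows B))) := by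
    rw [hI, latticeInstance_encode_toMat]
  rw [hcode]
  rfl

/-- The typed data are read off the instance code in polynomial time. [cite: AroraBarak2009, §1.3] -/
theorem svpTupFP : CodeFP GapSVPInstance.encode svpTupE svpTup :=
  (CodeFP.id GapSVPInstance.encode).recodeOut encode_eq_svpTupE

/-- The dimension (binary) from the code. [folklore] -/
theorem svpN_codeFP : CodeFP GapSVPInstance.encode natE (fun p => p.1.n) := (svpTupFP.fst'.fst' :)

/-- The threshold's numerator from the code. [folklore] -/
theorem svpNum_codeFP : CodeFP GapSVPInstance.encode intE (fun p => p.2.num) := (intOfSM.comp svpTupFP.snd'.fst' :)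

/-- The threshold's denominator from the code. [folklore] -/
theorem svpDen_codeFP : CodeFP GapSVPInstance.encode natE (fun p => p.2.den) := (svpTupFP.snd'.snd' :)

/-- The code itself as a string value (the ruler for unary conversions). [folklore] -/
theorem svpSelf_codeFP : CodeFP GapSVPInstance.encode strE GapSVPInstance.encode :=
  (CodeFP.id GapSVPInstance.encode).recodeOut fun _ => rfl

/-- **The dimension in unary from the code** (`n ≤ |code|`, so the capped conversion is exact).
[cite: MicciancioGoldwasser2002, Ch. 1 §1.3] -/
theorem svpNUn_codeFP : CodeFP GapSVPInstance.encode unE (fun p => p.1.n) := by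
  have h := (unOfNatMin.comp ((strLength.comp svpSelf_codeFP).pair svpN_codeFP) :)
  refine h.congr fun p => min_eq_left ?_
  obtain ⟨I, d⟩ := p
  show I.n ≤ (GapSVPInstance.encode (I, d)).length
  rw [gapSVPInstance_encode_eq, length_boolPair]
  have := I.n_le_length_encode
  omega

/-- The row-major entry list (integers, difference-pair code) from the code. [folklore] -/
theorem svpFlat_codeFP : CodeFP GapSVPInstance.encode (rawE intE) (fun p => rowMajor p.1.n (matRows p.1.basis)) := by
  have h := ((map₀ intOfSM).comp ((rawOfList smE).comp svpTupFP.fst'.snd') :)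
  exact h.congr fun p => by simp [svpTup]

/-- The rows read off a flat row-major list: `rowsOfFlat n flat = tab n n (i, j ↦ flat[i n + j])`. [folklore] -/
def rowsOfFlat (n : ℕ) (flat : List ℤ) : List (List ℤ) := tab n n fun i j => flat.getD (i * n + j) 0

/-- **The rows read off the row-major list of `B` are the `ofFn` rows of `B`.** [folklore] -/
theorem rowsOfFlat_rowMajor_matRows {n : ℕ} (B : Matrix (Fin n) (Fin n) ℤ) :
    rowsOfFlat n (rowMajor n (matRows B)) = matRows B := by
  refine List.ext_getElem (by simp [rowsOfFlat, tab, matRows]) fun i h₁ h₂ => ?_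
  have hi : i < n := by simpa [rowsOfFlat, tab] using h₁
  refine List.ext_getElem (by simp [rowsOfFlat, tab, matRows]) fun j h₃ h₄ => ?_
  have hj : j < n := by simpa [rowsOfFlat, tab] using h₃
  have hm : i * n + j < n * n := by nlinarith
  simp only [rowsOfFlat, tab, matRows, List.getElem_map, List.getElem_range, List.getElem_ofFn]
  rw [rowMajor, getD_map_range _ hm]
  have hdiv : (i * n + j) / n = i := by
    rw [Nat.add_comm, Nat.add_mul_div_right _ _ (by omega), Nat.div_eq_of_lt hj, Nat.zero_add]
  have hmod : (i * n + j) % n = j := by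
    rw [Nat.add_comm, Nat.add_mul_mod_self_right, Nat.mod_eq_of_lt hj]
  rw [hdiv, hmod]
  exact ent_matRows B ⟨i, hi⟩ ⟨j, hj⟩

/-- `rowsOfFlat` is typed polynomial time on `(1ⁿ, flat)`. [cite: AroraBarak2009, §1.3] -/
theorem rowsOfFlat_codeFP : CodeFP (pairE unE (rawE intE)) matE (fun p => rowsOfFlat p.1 p.2) := by
  -- inner item: context `((flat, n), i)`, item `j`
  have hitem : CodeFP (pairE (pairE (pairE (rawE intE) natE) natE) natE) intE
      (fun q => q.1.1.1.getD (q.1.2 * q.1.1.2 + q.2) 0) := by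
    have qflat : CodeFP (pairE (pairE (pairE (rawE intE) natE) natE) natE) (rawE intE) (fun q => q.1.1.1) := (fst _ _).fst'.fst'
    have qn : CodeFP (pairE (pairE (pairE (rawE intE) natE) natE) natE) natE (fun q => q.1.1.2) := (fst _ _).fst'.snd'
    have qi : CodeFP (pairE (pairE (pairE (rawE intE) natE) natE) natE) natE (fun q => q.1.2) := (fst _ _).snd'
    have qj : CodeFP (pairE (pairE (pairE (rawE intE) natE) natE) natE) natE (fun q => q.2) := snd _ _
    have qidx : CodeFP (pairE (pairE (pairE (rawE intE) natE) natE) natE) natE (fun q => q.1.2 * q.1.1.2 + q.2) :=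
      (natAdd.comp ((natMul.comp (qi.pair qn)).pair qj) :)
    exact ((rawGetOr intE).comp (qflat.pair (qidx.pair (const _ (0 : ℤ)))) :)
  -- a row: context `(flat, n)` (+ unary `n` for the range), item `i`
  have hrow : CodeFP (pairE (pairE (pairE (rawE intE) natE) unE) natE) (rawE intE)
      (fun q => (List.range q.1.2).map fun j => q.1.1.1.getD (q.2 * q.1.1.2 + j) 0) := by
    have h := ((map hitem).comp ((((fst _ _).fst').pair (snd _ _)).pair (urange.comp (fst _ _).snd')) :)
    exact h.congr fun q => rfl
  have hctx : CodeFP (pairE unE (rawE intE)) (pairE (pairE (rawE intE) natE) unE) (fun p => ((p.2, p.1), p.1)) :=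
    (((snd _ _).pair (natOfUn.comp (fst _ _))).pair (fst _ _) :)
  have h := ((map hrow).comp (hctx.pair (urange.comp (fst _ _))) :)
  exact h.congr fun p => rfl

/-- **The basis rows from the instance code**, as the list matrix `rowsOfFlat n (row-major list)`.
[cite: AroraBarak2009, §1.3] -/
theorem svpRows_codeFP : CodeFP GapSVPInstance.encode matE (fun p => rowsOfFlat p.1.n (rowMajor p.1.n (matRows p.1.basis))) :=
  (rowsOfFlat_codeFP.comp (svpNUn_codeFP.pair svpFlat_codeFP) :)

/-- The rows read off the code are the `ofFn` rows of the basis. [folklore] -/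
theorem svpRows_eq_matRows (p : GapSVPInstance) :
    rowsOfFlat p.1.n (rowMajor p.1.n (matRows p.1.basis)) = matRows p.1.basis :=
  rowsOfFlat_rowMajor_matRows p.1.basis

/-! ### Writing a `GapCVP` instance code -/

/-- **The code of the `GapCVP` instance `((⟨n, toMat n n rows⟩, xs), num/den)`** written from lists
(`xs` padded/truncated to `n` entries; `num/den` assumed in lowest terms). [cite: MicciancioGoldwasser2002, Ch. 1 Def. 1.5 / §1.2] -/
def cvpCode (n : ℕ) (rows : List (List ℤ)) (xs : List ℤ) (num : ℤ) (den : ℕ) : List Bool :=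
  boolPair (boolPair (encodeNat n) (boolPair (listE smE (rowMajor n rows)) (listE smE ((List.range n).map fun i => xs.getD i 0))))
    (boolPair (smE num) (encodeNat den))

/-- **`cvpCode` is the instance code** when `xs` lists the target and `(num, den)` is the reduced fraction of `r`.
[cite: MicciancioGoldwasser2002, Ch. 1 Def. 1.5 / §1.2] -/
theorem cvpCode_eq_encode (n : ℕ) (rows : List (List ℤ)) (t : Fin n → ℤ) (r : ℚ) :
    cvpCode n rows (List.ofFn t) r.num r.den = GapCVPInstance.encode (⟨⟨n, toMat n n rows⟩, t⟩, r) := by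
  rw [gapCVPInstance_encode_toMat, cvpCode]
  have h : ((List.range n).map fun i => (List.ofFn t).getD i 0) = List.ofFn t := by
    refine List.ext_getElem (by simp) fun i h₁ h₂ => ?_
    have hi : i < n := by simpa using h₂
    simp [List.getD_eq_getElem?_getD, hi]
  rw [h]

/-- The argument code of `cvpCode`: `⟨⟨⟨1ⁿ, rows⟩, xs⟩, ⟨num, den⟩⟩`. [folklore] -/
abbrev cvpArgE : ((ℕ × List (List ℤ)) × List ℤ) × (ℤ × ℕ) → List Bool :=
  pairE (pairE (pairE unE matE) (rawE intE)) (pairE intE natE)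

/-- **Writing the `GapCVP` code is typed polynomial time.** [cite: AroraBarak2009, §1.3; MicciancioGoldwasser2002, Ch. 1 §1.2] -/
theorem cvpCode_codeFP : CodeFP cvpArgE strE (fun p => cvpCode p.1.1.1 p.1.1.2 p.1.2 p.2.1 p.2.2) := by
  have hsm : CodeFP (rawE intE) (listE smE) (fun l => l) := ((listOfRaw smE).comp (map₀ smOfInt)).congr fun l => by simp
  have hn : CodeFP cvpArgE unE (fun p => p.1.1.1) := (fst _ _).fst'.fst'
  have hrows : CodeFP cvpArgE matE (fun p => p.1.1.2) := (fst _ _).fst'.snd'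
  have hxs : CodeFP cvpArgE (rawE intE) (fun p => p.1.2) := (fst _ _).snd'
  have hnum : CodeFP cvpArgE intE (fun p => p.2.1) := (snd _ _).fst'
  have hden : CodeFP cvpArgE natE (fun p => p.2.2) := (snd _ _).snd'
  have hmaj : CodeFP cvpArgE (listE smE) (fun p => rowMajor p.1.1.1 p.1.1.2) := (hsm.comp (rowMajorFP.comp (hn.pair hrows)) :)
  -- the padded target `[xs[0], …, xs[n-1]]`
  have hitem : CodeFP (pairE (rawE intE) natE) intE (fun q => q.1.getD q.2 0) :=
    ((rawGetOr intE).comp ((fst _ _).pair ((snd _ _).pair (const _ (0 : ℤ)))) :)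
  have htgt' := ((map hitem).comp (hxs.pair (urange.comp hn)) :)
  have htgt : CodeFP cvpArgE (listE smE) (fun p => (List.range p.1.1.1).map fun i => p.1.2.getD i 0) :=
    (hsm.comp htgt' :).congr fun p => rfl
  have h1 : CodeFP cvpArgE (pairE (pairE natE (pairE (listE smE) (listE smE))) (pairE smE natE))
      (fun p => ((p.1.1.1, (rowMajor p.1.1.1 p.1.1.2, (List.range p.1.1.1).map fun i => p.1.2.getD i 0)),
        (p.2.1, p.2.2))) :=
    (((natOfUn.comp hn).pair (hmaj.pair htgt)).pair ((smOfInt.comp hnum).pair hden) :)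
  exact h1.recodeOut fun p => rfl

end GapCodes

end Literature.Algebra.EuclideanLattices
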